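import Summits.QuantumFields.BalabanUV.T4Continuum.Support.NE7K1LinBoxHolderRow

/-!
# NE7K1LinBoxThm19HolderStep — row NE7 (node U5), candidate route HOM, path H1L, cell K1-lin(s): card §3y STEP 7, PART 10 —
# THE HÖLDER-DIFFERENCED FLUCTUATION TERM OF ONE RENORMALIZATION STEP OF THE LINE:
# `Σ_z (L^k∕|x′−x|)^α·L^k·|dd(𝒢_{j+1}(s) − 𝒢_j(s))(z)|·e^{δ₀min(|x−z|,|x′−z|)∕L^k} ≤ Θe^{δ₀}·s_j^α s_j^{−1}` — the `(L^jη)^{1−α}` of [B4] (2.38)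

Lineage `b2b-balaban-t4-ne7-p2` (CRUX PROVER NE7 #2), generation 79; file 103.  b04's `B4Thm19ZeroBoxHolder` §4 with `Gfine ↦ GfineL`:
`g_H(y) = (L^k/|x′−x|)^α·L^k·((A_j(xe′,y) − A_j(x′,y)) − (A_j(xe,y) − A_j(x,y)))`, `|g_H(y)| ≤ s_j^α s_j^{−1}C′e^{−κ·min(|blk x−y|, |blk x′−y|)}`
(file 102), split `g_H = g₁ + g₂` by the nearer centre, b04's generic `wsum_gCB_le` about `x` and about `x′`, `weight_smul_mul3_row_dd`,
`wsum2_*` BY NAME; (2.35) first quantity = file 95, (2.37) = file 81.  Net: **`step_termH_bound_line`**, `(κ₀, Θ)` in `(d, ℓ, α, a₋, a₊)`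
ONLY — no `s`, `k`, `j`, box.

HONEST FRAMING: [folklore]; A = 0; b04's proof text re-run with the line's inputs; nothing of Bałaban's asserted; no `sorry`.  Census
only (STEP 7, Hölder clause, step layer); NE7 NOT PRINTED ∕ NOT PROVED; spine 0∕9; FIXED FINITE T⁴, rung (B)+1; NOT infinite volume,
NOT mass gap, NOT Clay.  HONEST DEPENDENCY: continuum YM on T⁴ ⇐ BetaPertH ∧ nine spine estimates (0/9 proved); BetaPertH ⇐ (D1) ∧
(D4) ∧ CAP+tail; G-an2-4 gates asym, D1 and NE2/3/4.
-/

noncomputable section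

open Finset Matrix

namespace Summit.QuantumFields.BalabanUV.T4Continuum.NE7K1LinBoxThm19HolderStep

open Literature.MathematicalPhysics.QuantumFieldTheory.Balaban1983to89
open Literature.MathematicalPhysics.QuantumFieldTheory.Balaban1983to89.B4Reflection242
open Literature.MathematicalPhysics.QuantumFieldTheory.Balaban1983to89.B4Lower18
open Literature.MathematicalPhysics.QuantumFieldTheory.Balaban1983to89.B4ContourShift (supNorm supNorm_nonneg)
open Literature.MathematicalPhysics.QuantumFieldTheory.Balaban1983to89.B4BoxCov237
open Literature.MathematicalPhysics.QuantumFieldTheory.Balaban1983to89.B4Thm110ZeroBox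
open Literature.MathematicalPhysics.QuantumFieldTheory.Balaban1983to89.B4Thm110ZeroBoxDeriv
open Literature.MathematicalPhysics.QuantumFieldTheory.Balaban1983to89.B4Thm19ZeroBoxHolder
open Literature.MathematicalPhysics.QuantumFieldTheory.Balaban1983to89.B4StripSumsHolder (one_le_supNorm)
open Literature.MathematicalPhysics.QuantumFieldTheory.Balaban1983to89.B4Sect5Proof (latticeConst latticeConst_nonneg latticeSum_le)
open NE7K1LinSchurLineU1 NE7K1LinSchurFoldBox NE7K1LinBoxCovEnergy NE7K1LinLineLaplacian NE7K1LinBoxCov237 NE7K1LinBoxScales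
open NE7K1LinBoxRGStep NE7K1LinBoxThm110Step NE7K1LinBoxHolderRow

variable {d : ℕ}

/-! ### The Hölder-differenced fluctuation term of one renormalization step of the line

With `A_j = 𝒢_jQ_j^*`, `B_j = Q_j𝒢_j`, `C_j = s_j^{-2}C^{(j)}(□)` and `𝒢_{j+1} − 𝒢_j = α_j²·A_jC_jB_j`
(file 97's `GfineL_succ_sub`, the (2.34) recursion for the line), the doubly differenced, `L^k`-scaled and Hölder-weighted
row of the step is `α_j²·Σ_{y′,y} g_H(y)C_j(y,y′)B_j(y′,z)` with
`g_H(y) = (L^k/|x′−x|)^α·L^k·((A_j(xe′,y) − A_j(x′,y)) − (A_j(xe,y) − A_j(x,y)))`,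
`|g_H(y)| ≤ s_j^α s_j^{-1}C′e^{−κ·min(|blk x−y|, |blk x′−y|)}` (file 102): the factor `s_j^{-2}` of the value estimate is
replaced by `s_j^{-(1−α)}` — exactly the `(L^jη)^{1−α}` of [B4] (2.38)–(2.39).  The two-centre decay is handled by
splitting `g_H = g₁ + g₂` according to which of `blk x`, `blk x′` is nearer to `y` and applying the triple-product
estimate of `B4Thm110ZeroBoxDeriv` §2 about `x` to `g₁` and about `x′` to `g₂`. -/

section StepBound

variable {ℓ k j : ℕ} {M : Fin (d + 1) → ℕ} {a s : ℝ}

set_option maxHeartbeats 1600000 in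
/-- **THE HÖLDER-DIFFERENCED STEP BOUND FOR THE LINE**: for `0 ≤ α < 1` there are `κ₀ > 0`, `Θ ≥ 0` (depending on `d, ℓ, α` and the
window `[a₋,a₊]` only) such that for every weight rate `0 ≤ δ₀ ≤ κ₀`, every `1 ≤ j < k`, every `a` of the window, EVERY `s ∈ [0,1]`, every
box, every axis `μ` and all lattice neighbours `xe = x + e_μ`, `xe′ = x′ + e_μ` of the fine box with `x′ ≠ x`:
`Σ_z (L^k/|x′−x|_∞)^α·L^k·|((𝒢_{j+1} − 𝒢_j)(xe′,z) − (𝒢_{j+1} − 𝒢_j)(x′,z)) − ((𝒢_{j+1} − 𝒢_j)(xe,z) − (𝒢_{j+1} − 𝒢_j)(x,z))|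
·e^{δ₀min(|x−z|,|x′−z|)/L^k} ≤ Θe^{δ₀}·s_j^α s_j^{-1}` — b04's `step_termH_bound` re-run with the line's inputs (files 95 ∕ 102 ∕ 81).
[cite: Balaban1983RegularityDecay, p. 582 (2.34), (2.36), (2.38), for the two-cutoff line] -/
theorem step_termH_bound_line (d ℓ : ℕ) (hℓ : 1 ≤ ℓ) (amin aplus : ℝ) (ha : 0 < amin) {α : ℝ} (hα0 : 0 ≤ α)
    (hα1 : α < 1) :
    ∃ κ₀ Θ : ℝ, 0 < κ₀ ∧ 0 ≤ Θ ∧ ∀ (δ₀ : ℝ), 0 ≤ δ₀ → δ₀ ≤ κ₀ →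
      ∀ (k j : ℕ), 1 ≤ j → ∀ (hj : j + 1 ≤ k), ∀ (a s : ℝ), amin ≤ a → a ≤ aplus → 0 ≤ s →
        s ≤ 1 → ∀ (M : Fin (d + 1) → ℕ), (∀ i, 1 ≤ M i) →
        ∀ (μ : Fin (d + 1)) (x xe x' xe' : ↥(boxDom (Nf ℓ k M))), xe.1 = x.1 + Pi.single μ 1 →
          xe'.1 = x'.1 + Pi.single μ 1 → x'.1 ≠ x.1 →
          wsum2 δ₀ ((ℓ + 1) ^ k) x x' (fun z => ((((ℓ + 1) ^ k : ℕ) : ℝ) / supNorm (x'.1 - x.1)) ^ α *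
              ((((ℓ + 1) ^ k : ℕ) : ℝ) *
                (((GfineL ℓ k M (j + 1) a s - GfineL ℓ k M j a s) xe' z
                    - (GfineL ℓ k M (j + 1) a s - GfineL ℓ k M j a s) x' z)
                  - ((GfineL ℓ k M (j + 1) a s - GfineL ℓ k M j a s) xe z
                    - (GfineL ℓ k M (j + 1) a s - GfineL ℓ k M j a s) x z))))
            ≤ Θ * Real.exp δ₀ * (sc ℓ k j ^ α * (sc ℓ k j)⁻¹) := by
  obtain ⟨κ, C₁, hκ, hC₁, hR⟩ := GfineL_blockRow_bound d ℓ hℓ amin aplus ha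
  obtain ⟨κ', C', hκ', hC', hHf⟩ := GfineL_blockRowHolder_bound d ℓ hℓ amin aplus ha hα0 hα1
  obtain ⟨δ, c₂, hδ, hc₂, hCov⟩ := cov237S_box_decay d ℓ hℓ (amin * (1 - ((((ℓ : ℝ) + 1)) ^ 2)⁻¹)) aplus
    amin aplus (aminus'_pos hℓ ha) ha (ℓ + 1)
  have hK0 : ∀ t : ℝ, 0 < t → 0 ≤ latticeConst (d + 1) t := fun t ht => latticeConst_nonneg _ ht.le
  have hκ₁ : 0 < min κ κ' := lt_min hκ hκ'
  have hKκ := hK0 _ (half_pos hκ₁)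
  have hKδ := hK0 _ (half_pos hδ)
  refine ⟨min (min κ κ') δ / 2, 2 * (aplus ^ 2 * (C' * c₂ * C₁)
      * (latticeConst (d + 1) (min κ κ' / 2) * latticeConst (d + 1) (δ / 2)
          * latticeConst (d + 1) (min κ κ' / 2))),
    by positivity, ?_, ?_⟩
  · exact mul_nonneg (by norm_num) (mul_nonneg (mul_nonneg (sq_nonneg _)
      (mul_nonneg (mul_nonneg hC' hc₂.le) hC₁)) (mul_nonneg (mul_nonneg hKκ hKδ) hKκ))
  intro δ₀ hδ0 hδ1 k j hj1 hj a s h1 h2 h3 h4 M hM μ x xe x' xe' hxe hxe' hne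
  have ha0 : 0 < a := lt_of_lt_of_le ha h1
  obtain ⟨hw1, hw2, hapos⟩ := aSeq_window hℓ ha h1 h2 hj1
  have hs : 0 < sc ℓ k j ^ 2 := pow_pos (sc_pos ℓ k j) 2
  have hsi : 0 < (sc ℓ k j ^ 2)⁻¹ := inv_pos.2 hs
  have hs1i : 0 < (sc ℓ k j)⁻¹ := inv_pos.2 (sc_pos ℓ k j)
  have hsα : 0 ≤ sc ℓ k j ^ α := Real.rpow_nonneg (sc_pos ℓ k j).le α
  have hP0 : 0 ≤ sc ℓ k j ^ α * (sc ℓ k j)⁻¹ * C' := mul_nonneg (mul_nonneg hsα hs1i.le) hC'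
  have hsc0 : sc ℓ k j ≠ 0 := (sc_pos ℓ k j).ne'
  have hb1 : 1 ≤ bj ℓ j := bj_pos ℓ j
  have hbD : (0 : ℝ) < ((bj ℓ j : ℕ) : ℝ) ^ (d + 1) := by positivity
  have hδκ : δ₀ ≤ min κ κ' / 2 := hδ1.trans (by linarith [min_le_left (min κ κ') δ])
  have hδδ : δ₀ ≤ δ / 2 := hδ1.trans (by linarith [min_le_right (min κ κ') δ])
  -- the Hölder weight of the pair
  set W : ℝ := ((((ℓ + 1) ^ k : ℕ) : ℝ) / supNorm (x'.1 - x.1)) ^ α with hW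
  have hσ1 : 1 ≤ supNorm (x'.1 - x.1) := one_le_supNorm (sub_ne_zero.2 hne)
  have hW0 : 0 ≤ W := Real.rpow_nonneg (div_nonneg (Nat.cast_nonneg _) (le_trans zero_le_one hσ1)) α
  -- the doubly differenced, weighted block-row vector `g_H`
  set gH : ↥(boxDom (Mj ℓ k M j)) → ℝ := fun y => W * ((((ℓ + 1) ^ k : ℕ) : ℝ) *
      ((AmatL ℓ k M j a s xe' y - AmatL ℓ k M j a s x' y)
        - (AmatL ℓ k M j a s xe y - AmatL ℓ k M j a s x y))) with hgH
  have hg : ∀ y : ↥(boxDom (Mj ℓ k M j)), |gH y|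
      ≤ sc ℓ k j ^ α * (sc ℓ k j)⁻¹ * C' *
          Real.exp (-(min κ κ' *
            min (supNorm (blk (bj ℓ j) x.1 - y.1)) (supNorm (blk (bj ℓ j) x'.1 - y.1)))) := by
    intro y
    have hAd : (AmatL ℓ k M j a s xe' y - AmatL ℓ k M j a s x' y)
        - (AmatL ℓ k M j a s xe y - AmatL ℓ k M j a s x y)
        = ∑ x'', (if blk (bj ℓ j) x''.1 = y.1 then
            (GfineL ℓ k M j a s xe' x'' - GfineL ℓ k M j a s x' x'')
              - (GfineL ℓ k M j a s xe x'' - GfineL ℓ k M j a s x x'') else 0) := by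
      simp only [AmatL, Matrix.mul_apply, QksM, Matrix.of_apply, mul_ite, mul_one, mul_zero]
      rw [← Finset.sum_sub_distrib, ← Finset.sum_sub_distrib, ← Finset.sum_sub_distrib]
      refine Finset.sum_congr rfl fun x'' _ => ?_
      split_ifs <;> ring
    have habs : |gH y| = W * |(((ℓ + 1) ^ k : ℕ) : ℝ) * ∑ x'', (if blk (bj ℓ j) x''.1 = y.1 then
            (GfineL ℓ k M j a s xe' x'' - GfineL ℓ k M j a s x' x'')
              - (GfineL ℓ k M j a s xe x'' - GfineL ℓ k M j a s x x'') else 0)| := by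
      rw [hgH]
      dsimp only
      rw [hAd, abs_mul, abs_of_nonneg hW0]
    rw [habs]
    exact (hHf k j hj1 hj a s h1 h2 h3 h4 M hM μ x xe x' xe' hxe hxe' hne y.1 y.2).trans
      (mul_le_mul_of_nonneg_left (exp_rate_mono (min_le_right κ κ')
        (le_min (supNorm_nonneg _) (supNorm_nonneg _))) hP0)
  -- the split according to the nearer centre
  set g₁ : ↥(boxDom (Mj ℓ k M j)) → ℝ := fun y =>
    if supNorm (blk (bj ℓ j) x.1 - y.1) ≤ supNorm (blk (bj ℓ j) x'.1 - y.1) then gH y else 0 with hg₁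
  set g₂ : ↥(boxDom (Mj ℓ k M j)) → ℝ := fun y =>
    if supNorm (blk (bj ℓ j) x.1 - y.1) ≤ supNorm (blk (bj ℓ j) x'.1 - y.1) then 0 else gH y with hg₂
  have hg12 : ∀ y, gH y = g₁ y + g₂ y := by
    intro y
    simp only [hg₁, hg₂]
    split_ifs <;> simp
  have hg1 : ∀ y, |g₁ y| ≤ sc ℓ k j ^ α * (sc ℓ k j)⁻¹ * C' *
      Real.exp (-(min κ κ' * supNorm (blk (bj ℓ j) x.1 - y.1))) := by
    intro y
    simp only [hg₁]
    split_ifs with hle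
    · refine (hg y).trans (le_of_eq ?_)
      rw [min_eq_left hle]
    · rw [abs_zero]
      positivity
  have hg2 : ∀ y, |g₂ y| ≤ sc ℓ k j ^ α * (sc ℓ k j)⁻¹ * C' *
      Real.exp (-(min κ κ' * supNorm (blk (bj ℓ j) x'.1 - y.1))) := by
    intro y
    simp only [hg₂]
    split_ifs with hle
    · rw [abs_zero]
      positivity
    · refine (hg y).trans (le_of_eq ?_)
      rw [min_eq_right (le_of_lt (not_le.1 hle))]
  have hB : ∀ (y' : ↥(boxDom (Mj ℓ k M j))) (x'' : ↥(boxDom (Nf ℓ k M))),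
      |BmatL ℓ k M j a s y' x''| ≤ ((((bj ℓ j : ℕ) : ℝ)) ^ (d + 1))⁻¹ *
        ((sc ℓ k j ^ 2)⁻¹ * C₁ * Real.exp (-(min κ κ' * supNorm (blk (bj ℓ j) x''.1 - y'.1)))) := by
    intro y' x''
    have hBe : BmatL ℓ k M j a s y' x'' = ((((bj ℓ j : ℕ) : ℝ)) ^ (d + 1))⁻¹ *
        ∑ w, (if blk (bj ℓ j) w.1 = y'.1 then GfineL ℓ k M j a s x'' w else 0) := by
      simp only [BmatL, Matrix.mul_apply, QkM, Matrix.of_apply, Finset.mul_sum]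
      refine Finset.sum_congr rfl fun w _ => ?_
      split_ifs with hw
      · rw [(GfineL_isSymm ℓ k M j a s).apply x'' w]
      · rw [zero_mul, mul_zero]
    rw [hBe, abs_mul, abs_of_pos (inv_pos.2 hbD)]
    refine mul_le_mul_of_nonneg_left ?_ (inv_pos.2 hbD).le
    exact (hR k j hj1 hj a s h1 h2 h3 h4 M hM x'' y'.1 y'.2).trans
      (mul_le_mul_of_nonneg_left (exp_rate_mono (min_le_left κ κ') (supNorm_nonneg _))
        (mul_nonneg hsi.le hC₁))
  have hC : ∀ (y y' : ↥(boxDom (Mj ℓ k M j))),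
      |CmatL ℓ k M j a s y y'| ≤ (sc ℓ k j ^ 2)⁻¹ * c₂ * Real.exp (-(δ * supNorm (y.1 - y'.1))) := by
    intro y y'
    have h := (hCov (bj ℓ j) hb1 _ a s hw1 hw2 h1 h2 h3 h4 (Mp ℓ k M j) (Mp_pos hM)).2 y y'
    rw [CmatL, Matrix.smul_apply, smul_eq_mul, abs_mul, abs_of_pos hsi, mul_assoc]
    exact mul_le_mul_of_nonneg_left h hsi.le
  -- the two triple-product estimates, about `x` and about `x′`
  have htri1 := wsum_gCB_le hj M x g₁ (CmatL ℓ k M j a s) (BmatL ℓ k M j a s)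
    hP0 (mul_nonneg hsi.le hc₂.le) (mul_nonneg hsi.le hC₁) hκ₁ hδ hδ0 hδκ hδδ hg1 hC hB
  have htri2 := wsum_gCB_le hj M x' g₂ (CmatL ℓ k M j a s) (BmatL ℓ k M j a s)
    hP0 (mul_nonneg hsi.le hc₂.le) (mul_nonneg hsi.le hC₁) hκ₁ hδ hδ0 hδκ hδδ hg2 hC hB
  -- the weighted doubly differenced row of `α_j²A_jC_jB_j`
  have hfun : (fun z => W * ((((ℓ + 1) ^ k : ℕ) : ℝ) *
        (((GfineL ℓ k M (j + 1) a s - GfineL ℓ k M j a s) xe' z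
            - (GfineL ℓ k M (j + 1) a s - GfineL ℓ k M j a s) x' z)
          - ((GfineL ℓ k M (j + 1) a s - GfineL ℓ k M j a s) xe z
            - (GfineL ℓ k M (j + 1) a s - GfineL ℓ k M j a s) x z))))
      = fun z => αj a ℓ k j ^ 2 * ((∑ y', ∑ y, g₁ y * CmatL ℓ k M j a s y y' * BmatL ℓ k M j a s y' z)
          + (∑ y', ∑ y, g₂ y * CmatL ℓ k M j a s y y' * BmatL ℓ k M j a s y' z)) := by
    funext z
    rw [GfineL_succ_sub hℓ hj1 hj hM ha0 h3 h4, weight_smul_mul3_row_dd, ← Finset.sum_add_distrib]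
    congr 1
    refine Finset.sum_congr rfl fun y' _ => ?_
    rw [← Finset.sum_add_distrib]
    refine Finset.sum_congr rfl fun y _ => ?_
    have h12 := hg12 y
    rw [hgH] at h12
    simp only at h12
    rw [h12]
    ring
  have hα : αj a ℓ k j ^ 2 ≤ aplus ^ 2 * (sc ℓ k j ^ 2) ^ 2 := by
    unfold αj
    rw [mul_pow]
    exact mul_le_mul_of_nonneg_right (pow_le_pow_left₀ hapos.le hw2 2) (by positivity)
  rw [hfun, wsum2_mul_left _ _ _ _ (sq_nonneg _)]
  have hw2 := (wsum2_add_le δ₀ ((ℓ + 1) ^ k) x x'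
      (fun z => ∑ y', ∑ y, g₁ y * CmatL ℓ k M j a s y y' * BmatL ℓ k M j a s y' z)
      (fun z => ∑ y', ∑ y, g₂ y * CmatL ℓ k M j a s y y' * BmatL ℓ k M j a s y' z)).trans
    (add_le_add (wsum2_le_wsum_left hδ0 _ x x' _) (wsum2_le_wsum_right hδ0 _ x x' _))
  calc αj a ℓ k j ^ 2 * wsum2 δ₀ ((ℓ + 1) ^ k) x x'
        (fun z => (∑ y', ∑ y, g₁ y * CmatL ℓ k M j a s y y' * BmatL ℓ k M j a s y' z)
          + (∑ y', ∑ y, g₂ y * CmatL ℓ k M j a s y y' * BmatL ℓ k M j a s y' z))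
      ≤ (aplus ^ 2 * (sc ℓ k j ^ 2) ^ 2) *
          (sc ℓ k j ^ α * (sc ℓ k j)⁻¹ * C' * ((sc ℓ k j ^ 2)⁻¹ * c₂) * ((sc ℓ k j ^ 2)⁻¹ * C₁)
              * Real.exp δ₀ * (latticeConst (d + 1) (min κ κ' / 2) * latticeConst (d + 1) (δ / 2)
                  * latticeConst (d + 1) (min κ κ' / 2))
            + sc ℓ k j ^ α * (sc ℓ k j)⁻¹ * C' * ((sc ℓ k j ^ 2)⁻¹ * c₂) * ((sc ℓ k j ^ 2)⁻¹ * C₁)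
              * Real.exp δ₀ * (latticeConst (d + 1) (min κ κ' / 2) * latticeConst (d + 1) (δ / 2)
                  * latticeConst (d + 1) (min κ κ' / 2))) :=
        mul_le_mul hα (hw2.trans (add_le_add htri1 htri2)) (wsum2_nonneg _ _ _ _ _) (by positivity)
    _ = 2 * (aplus ^ 2 * (C' * c₂ * C₁)
          * (latticeConst (d + 1) (min κ κ' / 2) * latticeConst (d + 1) (δ / 2)
              * latticeConst (d + 1) (min κ κ' / 2)))
          * Real.exp δ₀ * (sc ℓ k j ^ α * (sc ℓ k j)⁻¹) := by
        field_simp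
        ring

end StepBound

end Summit.QuantumFields.BalabanUV.T4Continuum.NE7K1LinBoxThm19HolderStep

end
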